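import Literature.Barriers.FinalStateConjecture.ExtremalHorizonPointwiseDecayFromEnergy
import Literature.Geometry.Lorentzian.KerrStarEnergyIdentity
import HarnessLib

/-!
# Barrier catalogue `FinalStateConjecture`: conservation of the degenerate `T`-energy of
# axisymmetric waves outside the extremal Kerr horizon, and the horizon `T`-flux bound
# (Aretakis 2012, Prop. 5.1.2, for the class of `Aretakis2012_pointwiseDecay`)
# (`Literature/Barriers/FinalStateConjecture/`, D-0021, D-0014; family `gr`)

Written from the proving seat of `Literature.Barriers.FinalStateConjecture.Aretakis2012_pointwiseDecay`
(Aretakis, JFA 263 (2012), Thm. 5). By `ExtremalHorizonPointwiseDecayFromEnergy.lean` that named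
fact rests on two energy statements for the (globally smooth, axisymmetric) members `Φ` of
Aretakis's class — uniform boundedness of `∫∫∫_M^{R₂} sin θ (Φ² + (∂_ρΦ)²)` on the Kerr–Schild
leaves and integrability in time of `∫∫∫_M^{R₂} sin θ (Φ² + (r − M)²(∂_ρΦ)²)` — i.e. on Thms. 1–2
of the source, whose proofs (§§5–13) are energy identities for vector-field multipliers on the
region `{r ≥ M}` between two leaves. **This file proves the first of these identities for the class,
in the catalogue's vocabulary: the conservation law of the Killing multiplier `T = ∂_{t*}`
(Prop. 5.1.2) with the horizon flux made explicit**, by pulling back the coordinate identity of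
`Geometry/Lorentzian/KerrStarEnergyIdentity.lean` along the Kerr-star chart `κ`
(`Kerr.starChart`; `κ(t, r, θ, φ₀) = Kerr.shellPoint M t r θ φ₀`, `starChart_boxPoint`):

* `Kerr.degTEnergyDensity M Φ t r θ φ₀ = ½ sin θ ((r − M)²(∂_ρΦ)² + (r² + M²cos²θ + 2Mr)(TΦ)² + (∂_ΘΦ)²)`
  at `p = p(t, r, θ, φ₀)` — the degenerate `T`-energy density through the leaf `{t* = t}` in the
  coordinates `(r, θ)` (`= e_T[Φ ∘ κ]`, `tEnergy_starPull_boxPoint`; Aretakis's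
  `J^T_μ[ψ]n^μ_Σ ∼ (Tψ)² + (1 − M/r)²(Yψ)² + |∇̸ψ|²`, §5.1);
* `Kerr.degTEnergy_antitone_and_horizonFlux_le` (**Prop. 5.1.2 for the class**): for `Φ` smooth on
  an open `U₀ ⊇ {r ≥ M, t* ≥ 0}`, axisymmetric on `{r > 0}`, solving `□_{g_{M,M}}Φ = 0` on `U₀`,
  and `0 ≤ t₁ ≤ t₂`, `M ≤ r₂` with `dΦ = 0` on the cylinder `{r = r₂}` for `t ∈ [t₁, t₂]`:
  `E(t₂) ≤ E(t₁)` and `2M² ∫_{t₁}^{t₂}∫₀^π sin θ (TΦ)²(p_t(θ, φ₀)) dθ dt ≤ E(t₁) − E(t₂)`, where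
  `E(t) = ∫₀^π∫_M^{r₂} degTEnergyDensity M Φ t r θ φ₀ dr dθ` (per unit `φ*`; the integrands of
  axisymmetric functions do not depend on `φ₀`). The equation enters through
  `Kerr.separated_equations_starPull` (`𝓡G + 𝓐G = 0` off the axis for `G = Φ ∘ κ`,
  `ExtremalHorizonCarterOperator.lean`).

Everything is proved; no named facts (D-0026). What this does NOT give: the non-degenerate
(`J^N`) boundedness and the integrated decay required by
`Aretakis2012_pointwiseDecay_of_uniformBoundedness_of_integratedDecay` — those are Thms. 1–2 of the
source (the currents of §§8–13), for which the present identity is the `T`-part.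

## References

* S. Aretakis, *Decay of axisymmetric solutions of the wave equation on extreme Kerr backgrounds*,
  J. Funct. Anal. 263 (2012) 2770–2831 (arXiv:1110.2006): §5.1, Prop. 5.1.1 (non-negativity of
  `J^T n` for axisymmetric `ψ`), the remark after it (`J^T n ∼ (Tψ)² + (1 − M/r)²(Yψ)² + |∇̸ψ|²`,
  `∫_{𝓗⁺} J^T ≥ 0`), Prop. 5.1.2 (conservation of the degenerate energy) (key `Aretakis2012`).
* M. Dafermos, I. Rodnianski, arXiv:0811.0354, App. D (key `DafermosRodnianski2008`).
-/

noncomputable section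

open Set Filter MeasureTheory intervalIntegral
open scoped Topology ContDiff Manifold

namespace Literature.Barriers.FinalStateConjecture.Kerr

open Literature.Geometry.Lorentzian
open Literature.Geometry.Lorentzian.Kerr.StarCoord

/-- The chart point of the coordinate box: `κ(t, r, θ, φ₀) = p(t, r, θ, φ₀)` (`shellPoint`).
[cite: Aretakis2012, §2.5] -/
theorem starChart_boxPoint (M φ₀ t r θ : ℝ) :
    Kerr.starChart M (boxPoint φ₀ t r θ) = shellPoint M t r θ φ₀ := rfl

/-- **The degenerate `T`-energy density of `Φ` on the Kerr–Schild leaves in the coordinates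
`(r, θ)` (at `φ₀`)**: `½ sin θ ((r − M)²(∂_ρΦ)² + (r² + M²cos²θ + 2Mr)(TΦ)² + (∂_ΘΦ)²)` at
`p = p(t, r, θ, φ₀)`, where `∂_ρΦ = dΦ(p)(0, n̂)`, `TΦ = dΦ(p)∂_{t*}` and
`∂_ΘΦ = dΦ(p)(0, r θ̂ + M cos θ φ̂)` is the derivative along the coordinate field `∂_θ` of the
ingoing spheroidal coordinates — the pull-back of `Kerr.StarCoord.tEnergy` (the coordinate form of
`J^T_μ[ψ]n^μ_Σ ∼ (Tψ)² + (1 − M/r)²(Yψ)² + |∇̸ψ|²`, Aretakis 2012, §5.1). [cite: Aretakis2012, §5.1] -/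
def degTEnergyDensity (M : ℝ) (Φ : E4 → ℝ) (t r θ φ₀ : ℝ) : ℝ :=
  1 / 2 * Real.sin θ * ((r - M) ^ 2 *
    (fderiv ℝ Φ (shellPoint M t r θ φ₀) (E4.spaceEmbed (sphRadial θ φ₀))) ^ 2 +
    (r ^ 2 + M ^ 2 * Real.cos θ ^ 2 + 2 * M * r) *
      (fderiv ℝ Φ (shellPoint M t r θ φ₀) (E4.basisVector 0)) ^ 2 +
    (fderiv ℝ Φ (shellPoint M t r θ φ₀)
      (E4.spaceEmbed (r • sphPolar θ φ₀ + (M * Real.cos θ) • sphAzimuth φ₀))) ^ 2)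

/-- The pull-back identity: `e_T[Φ ∘ κ](t, r, θ, φ₀)` is the degenerate `T`-energy density of `Φ`
(for `Φ` differentiable at the shell point). [cite: Aretakis2012, §5.1] -/
theorem tEnergy_starPull_boxPoint {M : ℝ} {Φ : E4 → ℝ} {t r θ φ₀ : ℝ}
    (hΦ : DifferentiableAt ℝ Φ (shellPoint M t r θ φ₀)) :
    tEnergy M M (Kerr.starPull M Φ) (boxPoint φ₀ t r θ) = degTEnergyDensity M Φ t r θ φ₀ := by
  have hΦ' : DifferentiableAt ℝ Φ (Kerr.starChart M (boxPoint φ₀ t r θ)) := by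
    rw [starChart_boxPoint]; exact hΦ
  have hd : ∀ i, pd i (Kerr.starPull M Φ) (boxPoint φ₀ t r θ) =
      fderiv ℝ Φ (shellPoint M t r θ φ₀) (Kerr.starFrame M (boxPoint φ₀ t r θ) i) := fun i ↦ by
    rw [pd_apply, Kerr.fderiv_starPull hΦ' i, starChart_boxPoint]
  simp only [tEnergy, degTEnergyDensity, hd, Kerr.starFrame_zero, Kerr.starFrame_one,
    Kerr.starFrame_two, boxPoint_apply_one, boxPoint_apply_two, boxPoint_apply_three]
  ring

/-- The pull-back of the horizon flux density: `∂_{t*}(Φ ∘ κ)(t, M, θ, φ₀) = TΦ(p_t(θ, φ₀))` on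
the horizon sphere. [cite: Aretakis2012, §5.1] -/
theorem pd_zero_starPull_boxPoint_horizon {M : ℝ} {Φ : E4 → ℝ} {t θ φ₀ : ℝ}
    (hΦ : DifferentiableAt ℝ Φ (horizonPoint M t θ φ₀)) :
    pd 0 (Kerr.starPull M Φ) (boxPoint φ₀ t M θ) =
      fderiv ℝ Φ (horizonPoint M t θ φ₀) (E4.basisVector 0) := by
  have hΦ' : DifferentiableAt ℝ Φ (Kerr.starChart M (boxPoint φ₀ t M θ)) := by
    rw [starChart_boxPoint, shellPoint_self]; exact hΦ
  rw [pd_apply, Kerr.fderiv_starPull hΦ' 0, Kerr.starFrame_zero, starChart_boxPoint, shellPoint_self]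

section Conservation

variable [Kerr.Facts] [Kerr.SliceFacts] {M r₀ : ℝ} {U₀ : Set (Kerr.region M r₀)} {Φ : E4 → ℝ}

/-- **Conservation of the degenerate `T`-energy outside the extremal horizon and the horizon
`T`-flux bound, for Aretakis's class (Aretakis 2012, Prop. 5.1.2 and `∫_{𝓗⁺} J^T ≥ 0`).** Let
`Φ` be `C^∞` at the points of an open set `U₀ ⊇ {r ≥ M, t* ≥ 0}` of the extremal Kerr–Schild
chart, axisymmetric on `{r > 0}`, with `□_{g_{M,M}} Φ = 0` on `U₀`; let `0 ≤ t₁ ≤ t₂`, `M ≤ r₂`,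
and suppose `dΦ = 0` at the points `p(t, r₂, θ, φ₀)`, `t ∈ [t₁, t₂]`, `θ ∈ [0, π]` (no energy flows
through the cylinder `{r = r₂}`; e.g. `r₂` beyond the support of the wave). Then, with
`E(t) = ∫₀^π∫_M^{r₂} degTEnergyDensity M Φ t r θ φ₀ dr dθ` (the degenerate `T`-energy of the
shell `{M ≤ r ≤ r₂} ⊂ Σ_t` per unit `φ*`; axisymmetric integrands do not depend on `φ₀`):
`E(t₂) ≤ E(t₁)` and `2M² ∫_{t₁}^{t₂}∫₀^π sin θ (TΦ)²(p_t(θ, φ₀)) dθ dt ≤ E(t₁) − E(t₂)`.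
Proof: `Kerr.StarCoord.tEnergy_extremal_antitone` for `G = Φ ∘ κ` on
`W₀ = {r > 0} ∩ κ⁻¹(U₀)`, where `𝓡G + 𝓐G = 0` off the axis
(`Kerr.separated_equations_starPull`). [cite: Aretakis2012, §5.1 (Prop. 5.1.2)] -/
theorem degTEnergy_antitone_and_horizonFlux_le (hM : 0 < M) (hr₀ : r₀ ∈ Set.Ioo 0 M)
    (hU₀ : IsOpen U₀)
    (hKU : {x : Kerr.region M r₀ | Kerr.rPlus M M ≤ Kerr.radius M (x : E4) ∧ 0 ≤ (x : E4) 0} ⊆ U₀)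
    (hΦ : ∀ x ∈ U₀, ContDiffAt ℝ ∞ Φ x)
    (haxi : ∀ (β : ℝ) (z : E4), 0 < Kerr.radius M z → Φ (E4.axialRotation β z) = Φ z)
    (hsol : ∀ x ∈ U₀, (Kerr.smoothMetric M M r₀).toPseudoRiemannianMetric.dalembertian
      (fun y : Kerr.region M r₀ ↦ Φ y) x = 0)
    {t₁ t₂ r₂ φ₀ : ℝ} (ht₁ : 0 ≤ t₁) (ht : t₁ ≤ t₂) (hr : M ≤ r₂)
    (hfar : ∀ t ∈ Icc t₁ t₂, ∀ θ ∈ Icc (0 : ℝ) Real.pi, fderiv ℝ Φ (shellPoint M t r₂ θ φ₀) = 0) :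
    (∫ θ in (0 : ℝ)..Real.pi, ∫ r in M..r₂, degTEnergyDensity M Φ t₂ r θ φ₀) ≤
        ∫ θ in (0 : ℝ)..Real.pi, ∫ r in M..r₂, degTEnergyDensity M Φ t₁ r θ φ₀ ∧
      2 * M ^ 2 * (∫ t in t₁..t₂, ∫ θ in (0 : ℝ)..Real.pi,
          Real.sin θ * (fderiv ℝ Φ (horizonPoint M t θ φ₀) (E4.basisVector 0)) ^ 2) ≤
        (∫ θ in (0 : ℝ)..Real.pi, ∫ r in M..r₂, degTEnergyDensity M Φ t₁ r θ φ₀) -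
          ∫ θ in (0 : ℝ)..Real.pi, ∫ r in M..r₂, degTEnergyDensity M Φ t₂ r θ φ₀ := by
  obtain ⟨hr₀pos, hr₀M⟩ := hr₀
  have hπ := Real.pi_pos
  -- the coordinate open set and the separated equation off the axis
  set V : Set E4 := Subtype.val '' U₀ with hVdef
  have hV : IsOpen V := (Kerr.region M r₀).isOpen.isOpenMap_subtype_val U₀ hU₀
  have hΦV : ∀ z ∈ V, ContDiffAt ℝ ∞ Φ z := by
    rintro _ ⟨y, hyU, rfl⟩; exact hΦ y hyU
  set W₀ : Set E4 := {q : E4 | 0 < q 1 ∧ Kerr.starChart M q ∈ V} with hW₀def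
  have hW₀ : IsOpen W₀ := (isOpen_lt continuous_const (PiLp.continuous_apply 2 _ 1)).inter
    (hV.preimage (Kerr.contDiff_starChart M (n := 0)).continuous)
  set G : E4 → ℝ := Kerr.starPull M Φ with hGdef
  have hG : ContDiffOn ℝ ∞ G W₀ := fun q hq ↦
    (Kerr.contDiffAt_comp_starChart (hΦV _ hq.2)).contDiffWithinAt
  obtain ⟨-, -, -, hsep, -⟩ := separated_equations_starPull hU₀ hΦ haxi hsol
  have hP : ∀ q ∈ W₀, Real.sin (q 2) ≠ 0 → radOp M M G q + angOp M G q = 0 :=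
    fun q hq hs ↦ hsep q ⟨hq.1, hs, hq.2⟩
  -- the box lies in `W₀`
  have hK'reg : ∀ x : E4, Kerr.rPlus M M ≤ Kerr.radius M x ∧ 0 ≤ x 0 → x ∈ Kerr.region M r₀ := by
    intro x hx
    rw [Kerr.mem_region]
    have h1 := hx.1
    rw [Kerr.rPlus_self] at h1
    exact max_lt (by linarith) (by linarith)
  have hbox : ∀ t ∈ Icc t₁ t₂, ∀ r ∈ Icc M r₂, ∀ θ ∈ Icc 0 Real.pi, boxPoint φ₀ t r θ ∈ W₀ := by
    intro t ht' r hr' θ _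
    have hK := shellPoint_mem_horizonFutureSet hM (ht₁.trans ht'.1) hr'.1 θ φ₀
    refine ⟨hM.trans_le hr'.1, ?_⟩
    rw [starChart_boxPoint]
    exact ⟨⟨_, hK'reg _ hK⟩, hKU hK, rfl⟩
  -- the outer flux vanishes
  have hfar' : ∀ t ∈ Icc t₁ t₂, ∀ θ ∈ Icc (0 : ℝ) Real.pi, tFluxR M M G (boxPoint φ₀ t r₂ θ) = 0 := by
    intro t ht' θ hθ
    have hq := hbox t ht' r₂ (right_mem_Icc.mpr hr) θ hθ
    have hd : DifferentiableAt ℝ Φ (Kerr.starChart M (boxPoint φ₀ t r₂ θ)) :=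
      (hΦV _ hq.2).differentiableAt (by simp)
    have h0 : pd 0 G (boxPoint φ₀ t r₂ θ) = 0 := by
      rw [pd_apply, hGdef, Kerr.fderiv_starPull hd 0, starChart_boxPoint, hfar t ht' θ hθ]
      rfl
    have h1 : pd 1 G (boxPoint φ₀ t r₂ θ) = 0 := by
      rw [pd_apply, hGdef, Kerr.fderiv_starPull hd 1, starChart_boxPoint, hfar t ht' θ hθ]
      rfl
    simp only [tFluxR, h0, h1, mul_zero, add_zero, zero_pow two_ne_zero]
  -- the coordinate statement
  obtain ⟨hE, hFlux⟩ := tEnergy_extremal_antitone hW₀ hG hP ht hr hbox hfar'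
  -- translate the energies
  have hEt : ∀ t ∈ Icc t₁ t₂, (∫ θ in (0 : ℝ)..Real.pi, ∫ r in M..r₂, tEnergy M M G (boxPoint φ₀ t r θ)) =
      ∫ θ in (0 : ℝ)..Real.pi, ∫ r in M..r₂, degTEnergyDensity M Φ t r θ φ₀ := by
    intro t ht'
    refine intervalIntegral.integral_congr fun θ hθ ↦ ?_
    rw [uIcc_of_le hπ.le] at hθ
    refine intervalIntegral.integral_congr fun r hr' ↦ ?_
    rw [uIcc_of_le hr] at hr'
    have hq := hbox t ht' r hr' θ hθ
    have hd : DifferentiableAt ℝ Φ (shellPoint M t r θ φ₀) := by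
      rw [← starChart_boxPoint]; exact (hΦV _ hq.2).differentiableAt (by simp)
    exact tEnergy_starPull_boxPoint hd
  -- translate the horizon flux
  have hHt : (∫ t in t₁..t₂, ∫ θ in (0 : ℝ)..Real.pi,
      2 * M ^ 2 * Real.sin θ * pd 0 G (boxPoint φ₀ t M θ) ^ 2) =
      2 * M ^ 2 * ∫ t in t₁..t₂, ∫ θ in (0 : ℝ)..Real.pi,
        Real.sin θ * (fderiv ℝ Φ (horizonPoint M t θ φ₀) (E4.basisVector 0)) ^ 2 := by
    rw [← intervalIntegral.integral_const_mul]
    refine intervalIntegral.integral_congr fun t ht' ↦ ?_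
    rw [uIcc_of_le ht] at ht'
    rw [← intervalIntegral.integral_const_mul]
    refine intervalIntegral.integral_congr fun θ hθ ↦ ?_
    rw [uIcc_of_le hπ.le] at hθ
    have hq := hbox t ht' M (left_mem_Icc.mpr hr) θ hθ
    have hd : DifferentiableAt ℝ Φ (horizonPoint M t θ φ₀) := by
      rw [← shellPoint_self, ← starChart_boxPoint]; exact (hΦV _ hq.2).differentiableAt (by simp)
    rw [pd_zero_starPull_boxPoint_horizon hd]
    ring
  rw [hEt t₂ (right_mem_Icc.mpr ht), hEt t₁ (left_mem_Icc.mpr ht)] at hE hFlux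
  rw [hHt] at hFlux
  exact ⟨hE, hFlux⟩

end Conservation

end Literature.Barriers.FinalStateConjecture.Kerr

end
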